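import Literature.Topology.FourManifolds.GroupTrisections
import Mathlib.GroupTheory.NoncommCoprod
import Mathlib.Algebra.Group.Equiv.TypeTags
import Mathlib.Algebra.Group.Commute.Basic
import HarnessLib

/-!
# The genus-`1` surface group is `ℤ × ℤ` (Hatcher, §1.2, p. 51, with Example 1.13)

Topic `Literature/Topology/FourManifolds`; companion to `GroupTrisections.lean`, which defines the
surface groups `S_g = ⟨a₁, b₁, …, a_g, b_g ∣ ∏ᵢ [aᵢ, bᵢ]⟩` (`SurfaceGroup g`, a `PresentedGroup`)
of Abrams–Gay–Kirby's group trisections.  Written for the fact seat of (g′)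
`exists_marking_centralSurface_of_gkTrisection` (`TrisectionFunctorGK.lean`: the central surface
of a genus-`g` Gay–Kirby trisection carries a marking `S_g ≃* π₁(F, x₀)`), whose genus-`1` case
needs the algebraic half proved here: **`S_1 = ⟨a, b ∣ aba⁻¹b⁻¹⟩ ≅ ℤ × ℤ`**, so that any space
whose fundamental group is `ℤ × ℤ` — the torus, Hatcher Example 1.13,
`Literature/AlgebraicTopology/FundamentalGroup/CircleAndTorus.lean` — is marked by `S_1`
(`nonempty_surfaceGroup_one_mulEquiv`).

## Contents (all proved; no named facts)

* `lift_surfaceRelator_eq_one_of_comm`, `SurfaceGroup.toCommGroup` — every assignment of the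
  `2g` generators in a **commutative** group extends to a homomorphism `S_g →* G` (the relator
  is a product of commutators; Hatcher, §1.2, p. 51: "The abelianization of `π₁(M_g)` is the
  direct sum of `2g` copies of `ℤ`" — only the easy direction "homs to abelian groups are
  free on the generators" is used and proved here).
* `surfaceRelator_one`, `SurfaceGroup.commute_a_b_one` — in genus `1` the relator is the single
  commutator `aba⁻¹b⁻¹`, so `a` and `b` commute in `S_1`.
* `surfaceGroupOneEquiv : SurfaceGroup 1 ≃* Multiplicative (ℤ × ℤ)`, `a ↦ (1, 0)`, `b ↦ (0, 1)`,
  inverse `(m, n) ↦ aᵐbⁿ` (`surfaceGroupOneEquiv_a/_b/_symm_apply`); `SurfaceGroup.mul_comm_one`.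

## References

* A. Hatcher, *Algebraic Topology*, CUP (2002), §1.2, p. 51 (`π₁(M_g) ≈ ⟨a₁, b₁, …, a_g, b_g ∣
  [a₁, b₁]⋯[a_g, b_g]⟩` and its abelianisation `ℤ^{2g}`); Example 1.13, p. 34
  (`π₁(S¹ × S¹) ≈ ℤ × ℤ`). [HatcherAT2002]
* A. Abrams, D. Gay, R. Kirby, *Group trisections and smooth 4-manifolds*, Geom. Topol. 22
  (2018), §1 (the surface group `S_g`). [AbramsGayKirby2018]
-/

noncomputable section

namespace Literature.Topology.FourManifolds

open Multiplicative

variable {g : ℕ}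

/-! ### Homomorphisms from `S_g` to commutative groups -/

/-- A map of generators into a **commutative** group kills the surface relator
`∏ᵢ [aᵢ, bᵢ]` (each commutator dies). [cite: HatcherAT2002, §1.2 p. 51] -/
theorem lift_surfaceRelator_eq_one_of_comm {G : Type*} [CommGroup G] (f : surfaceGen g → G) :
    FreeGroup.lift f (surfaceRelator g) = 1 := by
  unfold surfaceRelator
  rw [map_list_prod, List.map_map]
  apply List.prod_eq_one
  intro x hx
  rw [List.mem_map] at hx
  obtain ⟨i, -, rfl⟩ := hx
  simp [genA, genB, mul_comm]

/-- The homomorphism `S_g →* G` to a commutative group `G` determined by the images of the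
generators (every assignment extends, as `G` is abelian). [cite: HatcherAT2002, §1.2 p. 51] -/
def SurfaceGroup.toCommGroup {G : Type*} [CommGroup G] (f : surfaceGen g → G) :
    SurfaceGroup g →* G :=
  PresentedGroup.toGroup (f := f) (by
    rintro r hr
    rw [Set.mem_singleton_iff] at hr
    subst hr
    exact lift_surfaceRelator_eq_one_of_comm f)

/-- `toCommGroup f` on a generator. [folklore] -/
@[simp] theorem SurfaceGroup.toCommGroup_of {G : Type*} [CommGroup G] (f : surfaceGen g → G)
    (x : surfaceGen g) :
    SurfaceGroup.toCommGroup f (PresentedGroup.of x) = f x :=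
  PresentedGroup.toGroup.of _

/-- `toCommGroup f (aᵢ) = f (i, false)`. [folklore] -/
@[simp] theorem SurfaceGroup.toCommGroup_a {G : Type*} [CommGroup G] (f : surfaceGen g → G)
    (i : Fin g) : SurfaceGroup.toCommGroup f (SurfaceGroup.a i) = f (i, false) :=
  PresentedGroup.toGroup.of _

/-- `toCommGroup f (bᵢ) = f (i, true)`. [folklore] -/
@[simp] theorem SurfaceGroup.toCommGroup_b {G : Type*} [CommGroup G] (f : surfaceGen g → G)
    (i : Fin g) : SurfaceGroup.toCommGroup f (SurfaceGroup.b i) = f (i, true) :=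
  PresentedGroup.toGroup.of _

/-- The surface relator is trivial in `S_g`. [folklore] -/
theorem SurfaceGroup.mk_surfaceRelator :
    PresentedGroup.mk ({surfaceRelator g} : Set (FreeGroup (surfaceGen g))) (surfaceRelator g) = 1 :=
  PresentedGroup.one_of_mem rfl

/-! ### Genus `1`: `S_1 = ⟨a, b ∣ aba⁻¹b⁻¹⟩ ≅ ℤ × ℤ` -/

/-- The genus-`1` surface relator is the single commutator `a b a⁻¹ b⁻¹`. [cite: HatcherAT2002, §1.2 p. 51] -/
theorem surfaceRelator_one :
    surfaceRelator 1 = genA 0 * genB 0 * (genA 0)⁻¹ * (genB 0)⁻¹ := by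
  simp [surfaceRelator, List.finRange_succ]

/-- In `S_1` the two generators commute: `ab = ba`. [cite: HatcherAT2002, §1.2 p. 51] -/
theorem SurfaceGroup.commute_a_b_one :
    Commute (SurfaceGroup.a (0 : Fin 1)) (SurfaceGroup.b 0) := by
  have h := (SurfaceGroup.mk_surfaceRelator (g := 1))
  rw [surfaceRelator_one, map_mul, map_mul, map_mul, map_inv, map_inv,
    mul_inv_eq_one, mul_inv_eq_iff_eq_mul] at h
  exact h

/-- The images of the generators of `S_1` in `ℤ × ℤ`: `a ↦ (1, 0)`, `b ↦ (0, 1)`. [folklore] -/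
def genusOneGenImage : surfaceGen 1 → Multiplicative (ℤ × ℤ)
  | (_, false) => ofAdd (1, 0)
  | (_, true) => ofAdd (0, 1)

/-- `S_1 →* ℤ × ℤ`, `a ↦ (1, 0)`, `b ↦ (0, 1)`. [cite: HatcherAT2002, §1.2 p. 51] -/
def surfaceGroupOneToProd : SurfaceGroup 1 →* Multiplicative (ℤ × ℤ) :=
  SurfaceGroup.toCommGroup genusOneGenImage

/-- `ℤ × ℤ →* S_1`, `(m, n) ↦ aᵐ bⁿ` (a homomorphism because `a` and `b` commute in `S_1`).
[cite: HatcherAT2002, §1.2 p. 51] -/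
def prodToSurfaceGroupOne : Multiplicative (ℤ × ℤ) →* SurfaceGroup 1 :=
  (MonoidHom.noncommCoprod (zpowersHom (SurfaceGroup 1) (SurfaceGroup.a 0))
      (zpowersHom (SurfaceGroup 1) (SurfaceGroup.b 0))
      (fun m n => by simpa using Commute.zpow_zpow SurfaceGroup.commute_a_b_one m.toAdd n.toAdd)).comp
    (MulEquiv.prodMultiplicative (G := ℤ) (H := ℤ)).toMonoidHom

/-- `prodToSurfaceGroupOne (m, n) = aᵐ bⁿ`. [folklore] -/
theorem prodToSurfaceGroupOne_apply (m n : ℤ) :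
    prodToSurfaceGroupOne (ofAdd (m, n)) = SurfaceGroup.a 0 ^ m * SurfaceGroup.b 0 ^ n := by
  simp [prodToSurfaceGroupOne]

/-- `surfaceGroupOneToProd a = (1, 0)`. [folklore] -/
theorem surfaceGroupOneToProd_a : surfaceGroupOneToProd (SurfaceGroup.a 0) = ofAdd (1, 0) :=
  SurfaceGroup.toCommGroup_a _ _

/-- `surfaceGroupOneToProd b = (0, 1)`. [folklore] -/
theorem surfaceGroupOneToProd_b : surfaceGroupOneToProd (SurfaceGroup.b 0) = ofAdd (0, 1) :=
  SurfaceGroup.toCommGroup_b _ _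

/-- `(m, n) ↦ aᵐbⁿ` is a left inverse of `a ↦ (1, 0), b ↦ (0, 1)` (check on the two
generators of `S_1`, `PresentedGroup.ext`). [cite: HatcherAT2002, §1.2 p. 51] -/
theorem prodToSurfaceGroupOne_comp :
    prodToSurfaceGroupOne.comp surfaceGroupOneToProd = MonoidHom.id _ := by
  refine PresentedGroup.ext fun x => ?_
  obtain ⟨i, _ | _⟩ := x
  · obtain rfl : i = 0 := Subsingleton.elim _ _
    change prodToSurfaceGroupOne (surfaceGroupOneToProd (SurfaceGroup.a 0)) = SurfaceGroup.a 0
    rw [surfaceGroupOneToProd_a, prodToSurfaceGroupOne_apply]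
    simp
  · obtain rfl : i = 0 := Subsingleton.elim _ _
    change prodToSurfaceGroupOne (surfaceGroupOneToProd (SurfaceGroup.b 0)) = SurfaceGroup.b 0
    rw [surfaceGroupOneToProd_b, prodToSurfaceGroupOne_apply]
    simp

/-- `(m, n) ↦ aᵐbⁿ` is a right inverse of `a ↦ (1, 0), b ↦ (0, 1)` (`aᵐbⁿ ↦ (m, n)`).
[cite: HatcherAT2002, §1.2 p. 51] -/
theorem surfaceGroupOneToProd_comp :
    surfaceGroupOneToProd.comp prodToSurfaceGroupOne = MonoidHom.id _ := by
  have key : ∀ m n : ℤ,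
      surfaceGroupOneToProd (prodToSurfaceGroupOne (ofAdd (m, n))) = ofAdd (m, n) := by
    intro m n
    rw [prodToSurfaceGroupOne_apply, map_mul, map_zpow, map_zpow, surfaceGroupOneToProd_a,
      surfaceGroupOneToProd_b, ← ofAdd_zsmul, ← ofAdd_zsmul, ← ofAdd_add]
    congr 1
    simp
  exact MonoidHom.ext fun z => key z.toAdd.1 z.toAdd.2

/-- **The genus-`1` surface group is free abelian of rank `2`**:
`S_1 = ⟨a, b ∣ aba⁻¹b⁻¹⟩ ≅ ℤ × ℤ`, `a ↦ (1, 0)`, `b ↦ (0, 1)` — the fundamental group of the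
torus (Hatcher, §1.2 p. 51: `π₁(M_g) ≈ ⟨a₁, b₁, …, a_g, b_g ∣ [a₁, b₁]⋯[a_g, b_g]⟩`, whose
abelianisation is `ℤ^{2g}`; for `g = 1` the group is already abelian, Example 1.13:
`π₁(S¹ × S¹) ≈ ℤ × ℤ`). [cite: HatcherAT2002, §1.2 p. 51 and Example 1.13 (p. 34)] -/
def surfaceGroupOneEquiv : SurfaceGroup 1 ≃* Multiplicative (ℤ × ℤ) :=
  MonoidHom.toMulEquiv surfaceGroupOneToProd prodToSurfaceGroupOne prodToSurfaceGroupOne_comp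
    surfaceGroupOneToProd_comp

/-- `surfaceGroupOneEquiv a = (1, 0)`. [cite: HatcherAT2002, §1.2 p. 51] -/
@[simp] theorem surfaceGroupOneEquiv_a :
    surfaceGroupOneEquiv (SurfaceGroup.a 0) = ofAdd (1, 0) :=
  surfaceGroupOneToProd_a

/-- `surfaceGroupOneEquiv b = (0, 1)`. [cite: HatcherAT2002, §1.2 p. 51] -/
@[simp] theorem surfaceGroupOneEquiv_b :
    surfaceGroupOneEquiv (SurfaceGroup.b 0) = ofAdd (0, 1) :=
  surfaceGroupOneToProd_b

/-- The inverse of `surfaceGroupOneEquiv` is `(m, n) ↦ aᵐ bⁿ`. [cite: HatcherAT2002, §1.2 p. 51] -/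
theorem surfaceGroupOneEquiv_symm_apply (m n : ℤ) :
    surfaceGroupOneEquiv.symm (ofAdd (m, n)) = SurfaceGroup.a 0 ^ m * SurfaceGroup.b 0 ^ n :=
  prodToSurfaceGroupOne_apply m n

/-- `S_1` is abelian. [cite: HatcherAT2002, §1.2 p. 51] -/
theorem SurfaceGroup.mul_comm_one (x y : SurfaceGroup 1) : x * y = y * x :=
  surfaceGroupOneEquiv.injective (by rw [map_mul, map_mul, mul_comm])

/-- **Marking transfer in genus `1`**: a group isomorphic to `ℤ × ℤ` (e.g. the fundamental group
of a torus, Hatcher Example 1.13) is marked by the genus-`1` surface group, `S_1 ≃* Γ`.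
[cite: HatcherAT2002, §1.2 p. 51 and Example 1.13 (p. 34)] -/
theorem nonempty_surfaceGroup_one_mulEquiv {Γ : Type*} [Group Γ]
    (e : Γ ≃* Multiplicative (ℤ × ℤ)) : Nonempty (SurfaceGroup 1 ≃* Γ) :=
  ⟨surfaceGroupOneEquiv.trans e.symm⟩

end Literature.Topology.FourManifolds

end
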